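import Literature.MathematicalPhysics.QuantumFieldTheory.Balaban1983to89.T4BetaStationary

/-!
# Spine/NE4/KingCurrencyDini — one-sided (monotone-in-the-cutoff) families ARE King-admissible when their limit is continuous on
# the closed history box: Dini's theorem makes the n-shifts eventually small, uniformly ((R51)(iii); the sharpening of (R41) at the apex)

Cell `pub-balaban-gaps` (YM blitz G2), seat `ne4` generation 13 (unit `pub-balaban-gaps-ne4-g13`), record `HOME/ne/NE4.md` §5 census
item (R51)(iii).  Companion of `Spine/NE4/OneSidedNoGo` (generation 8, (R41): a family MONOTONE in the cutoff gives the continuum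
β-functional `T4BetaStationary.betaInf` WITHOUT rate and violates NE4 = `ScaleShiftRate` at every `θ < 1` — «not a door» to NE4) and
of `Spine/NE4/KingCurrency` ∕ `KingCurrencyPointwise` (generation 13, (R51): on King's route node U2 needs only the RATE-FREE n-shift
modulus, eventually small uniformly in the history).  THIS FILE: the one-sided families of (R41) DO feed King's route as soon as their
limit is continuous on the CLOSED box — by DINI's theorem (Mathlib `Monotone.tendstoUniformlyOn_of_forall_tendsto` on the compact
product `[0,γ]^ℕ`), with NO memory companion and NO rate:
* `isCompact_closedBox`: the closed history box `{h | ∀ a, h a ∈ [0, γ]}` (= `Set.pi univ (fun _ => Icc 0 γ)`; no definition is made) is compact in the product topology (Tychonoff);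
* `continuousOn_level`: `h ↦ β k (revHist h k)` is continuous when `β k` is (it reads finitely many coordinates);
* `shift_eventually_small_of_monotone`: `β k` continuous for every `k`, `k ↦ β k (revHist h k)` MONOTONE for every `h` in the closed
  box, converging there to a limit `B∞ h` that is CONTINUOUS on the closed box ⟹ for every `ε > 0` a `J` with
  `|β (j+n) (revHist h (j+n)) − β j (revHist h j)| ≤ ε` for all `j ≥ J`, all `n`, all `h` in the closed box (hence on the open boxes
  `]0,γ]`, where `KingCurrencyPointwise.revHist_pad_eq` turns it into the `prefixOf` form of `KingCurrency.UniformShift`); the antitone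
  twin `shift_eventually_small_of_antitone`.
(R41)'s own witness `expFamily` (`B·e^{−k·g_k}`) has a limit DIScontinuous at `g = 0` on the closed box and indeed fails the conclusion
(its n-shifts have supremum `B` at every scale) — so the continuity of the limit on the CLOSED box is where (R41)'s class splits.

HONEST FRAMING.  Elementary topology on hypothesis SHAPES (0 sorry, standard axioms); nothing of Bałaban's is asserted; whether
Bałaban's β-functions are monotone in the cutoff is NOT known or claimed; NE4 NOT IN PRINT ∕ NOT PROVED; spine PROVED 0∕9; rung (B)+1 on
ONE finite T⁴ — NOT ℝ⁴, NOT infinite volume, NOT a mass gap, NOT Clay.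

References (TYPES only): [Balaban1987RG1] = T. Bałaban, Commun. Math. Phys. **109** (1987) 249–301, §1 p. 264 («defined on the interval
[0, γ] … uniformly bounded»).
-/

noncomputable section

namespace Summit.QuantumFields.BalabanUV.T4Continuum.Spine.NE4.KingCurrencyDini

open Set Filter Topology
open Literature.MathematicalPhysics.QuantumFieldTheory.Balaban1983to89
open Literature.MathematicalPhysics.QuantumFieldTheory.Balaban1983to89.FlowStep
open Literature.MathematicalPhysics.QuantumFieldTheory.Balaban1983to89.T4BetaStationary

/-- Membership in the CLOSED history box `[0,γ]^ℕ = Set.pi univ (fun _ => Icc 0 γ)` (reversed histories with entries in the closed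
interval; written out in full everywhere below — no definition is made), coordinatewise. [folklore] -/
theorem mem_closedBox {γ : ℝ} {h : ℕ → ℝ} :
    h ∈ Set.pi Set.univ (fun _ : ℕ => Icc (0 : ℝ) γ) ↔ ∀ a, 0 ≤ h a ∧ h a ≤ γ := by
  simp only [Set.mem_univ_pi, Set.mem_Icc]

/-- Box-valued histories (`]0,γ]`) lie in the closed box. [folklore] -/
theorem mem_closedBox_of_seqBox {γ : ℝ} {h : ℕ → ℝ} (hh : SeqBox γ h) : h ∈ Set.pi Set.univ (fun _ : ℕ => Icc (0 : ℝ) γ) :=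
  mem_closedBox.mpr fun a => ⟨(hh a).1.le, (hh a).2⟩

/-- TYCHONOFF: the closed box is compact in the product topology. [folklore] -/
theorem isCompact_closedBox (γ : ℝ) : IsCompact (Set.pi Set.univ (fun _ : ℕ => Icc (0 : ℝ) γ)) :=
  isCompact_univ_pi fun _ => isCompact_Icc

/-- Reading a level-`k` prefix off a history is continuous in the product topology (finitely many coordinates). [folklore] -/
theorem continuous_revHist (k : ℕ) : Continuous fun h : ℕ → ℝ => revHist h k :=
  continuous_pi fun i => continuous_apply (k - (i : ℕ))

/-- If `β k` is continuous, `h ↦ β k (revHist h k)` is continuous on any set. [folklore] -/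
theorem continuousOn_level {β : HBeta} (hβ : ∀ k, Continuous (β k)) (k : ℕ) (S : Set (ℕ → ℝ)) :
    ContinuousOn (fun h : ℕ → ℝ => β k (revHist h k)) S :=
  ((hβ k).comp (continuous_revHist k)).continuousOn

/-- **DINI ON THE HISTORY BOX (monotone case).**  `β k` continuous for every `k`; along every history `h` of the CLOSED box the
β-values `k ↦ β k (revHist h k)` are MONOTONE (one-sided in the cutoff, (R41)'s class) and converge to `B∞ h`, with `B∞` CONTINUOUS on the
closed box (product topology).  THEN the n-shifts are eventually small, UNIFORMLY in the history and in the gap: for every `ε > 0`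
there is `J` with `|β (j+n) (revHist h (j+n)) − β j (revHist h j)| ≤ ε` for all `j ≥ J`, all `n`, all `h` in the closed box — the
rate-free King-currency input of `Spine/NE4/KingCurrency` (in the `revHist` currency), with NO memory companion and NO rate.  The
continuity of the limit on the CLOSED box is essential ((R41)'s `expFamily` fails it and the conclusion). [folklore] -/
theorem shift_eventually_small_of_monotone {β : HBeta} {γ : ℝ} {Binf : (ℕ → ℝ) → ℝ}
    (hβ : ∀ k, Continuous (β k))
    (hmono : ∀ h ∈ Set.pi Set.univ (fun _ : ℕ => Icc (0 : ℝ) γ), Monotone fun k => β k (revHist h k))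
    (hBinf : ContinuousOn Binf (Set.pi Set.univ (fun _ : ℕ => Icc (0 : ℝ) γ)))
    (hlim : ∀ h ∈ Set.pi Set.univ (fun _ : ℕ => Icc (0 : ℝ) γ), Tendsto (fun k => β k (revHist h k)) atTop (𝓝 (Binf h)))
    {ε : ℝ} (hε : 0 < ε) :
    ∃ J : ℕ, ∀ j n : ℕ, J ≤ j → ∀ h ∈ Set.pi Set.univ (fun _ : ℕ => Icc (0 : ℝ) γ),
      |β (j + n) (revHist h (j + n)) - β j (revHist h j)| ≤ ε := by
  have hDini : TendstoUniformlyOn (fun k (h : ℕ → ℝ) => β k (revHist h k)) Binf atTop (Set.pi Set.univ (fun _ : ℕ => Icc (0 : ℝ) γ)) :=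
    Monotone.tendstoUniformlyOn_of_forall_tendsto (isCompact_closedBox γ) (fun k => continuousOn_level hβ k _)
      hmono hBinf hlim
  rw [Metric.tendstoUniformlyOn_iff] at hDini
  have hev := hDini (ε / 2) (half_pos hε)
  obtain ⟨J, hJ⟩ := eventually_atTop.mp hev
  refine ⟨J, fun j n hj h hh => ?_⟩
  have h1 := hJ (j + n) (by omega) h hh
  have h2 := hJ j hj h hh
  rw [Real.dist_eq] at h1 h2
  have t := abs_sub_le (β (j + n) (revHist h (j + n))) (Binf h) (β j (revHist h j))
  rw [abs_sub_comm (Binf h)] at t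
  have e1 : |β (j + n) (revHist h (j + n)) - Binf h| = |Binf h - β (j + n) (revHist h (j + n))| := abs_sub_comm _ _
  have e2 : |β j (revHist h j) - Binf h| = |Binf h - β j (revHist h j)| := abs_sub_comm _ _
  linarith

/-- **DINI ON THE HISTORY BOX (antitone case)** — the same for families non-increasing in the cutoff. [folklore] -/
theorem shift_eventually_small_of_antitone {β : HBeta} {γ : ℝ} {Binf : (ℕ → ℝ) → ℝ}
    (hβ : ∀ k, Continuous (β k))
    (hanti : ∀ h ∈ Set.pi Set.univ (fun _ : ℕ => Icc (0 : ℝ) γ), Antitone fun k => β k (revHist h k))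
    (hBinf : ContinuousOn Binf (Set.pi Set.univ (fun _ : ℕ => Icc (0 : ℝ) γ)))
    (hlim : ∀ h ∈ Set.pi Set.univ (fun _ : ℕ => Icc (0 : ℝ) γ), Tendsto (fun k => β k (revHist h k)) atTop (𝓝 (Binf h)))
    {ε : ℝ} (hε : 0 < ε) :
    ∃ J : ℕ, ∀ j n : ℕ, J ≤ j → ∀ h ∈ Set.pi Set.univ (fun _ : ℕ => Icc (0 : ℝ) γ),
      |β (j + n) (revHist h (j + n)) - β j (revHist h j)| ≤ ε := by
  have hDini : TendstoUniformlyOn (fun k (h : ℕ → ℝ) => β k (revHist h k)) Binf atTop (Set.pi Set.univ (fun _ : ℕ => Icc (0 : ℝ) γ)) :=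
    Antitone.tendstoUniformlyOn_of_forall_tendsto (isCompact_closedBox γ) (fun k => continuousOn_level hβ k _)
      hanti hBinf hlim
  rw [Metric.tendstoUniformlyOn_iff] at hDini
  have hev := hDini (ε / 2) (half_pos hε)
  obtain ⟨J, hJ⟩ := eventually_atTop.mp hev
  refine ⟨J, fun j n hj h hh => ?_⟩
  have h1 := hJ (j + n) (by omega) h hh
  have h2 := hJ j hj h hh
  rw [Real.dist_eq] at h1 h2
  have t := abs_sub_le (β (j + n) (revHist h (j + n))) (Binf h) (β j (revHist h j))
  rw [abs_sub_comm (Binf h)] at t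
  have e1 : |β (j + n) (revHist h (j + n)) - Binf h| = |Binf h - β (j + n) (revHist h (j + n))| := abs_sub_comm _ _
  have e2 : |β j (revHist h j) - Binf h| = |Binf h - β j (revHist h j)| := abs_sub_comm _ _
  linarith

/-- In particular on the tree's OPEN boxes `]0,γ]` (`T4BetaStationary.SeqBox`): monotone + continuous sections + continuous limit on the closed
box ⟹ the n-shifts along every box-valued history are eventually `≤ ε`, uniformly. [folklore] -/
theorem shift_eventually_small_of_monotone_seqBox {β : HBeta} {γ : ℝ} {Binf : (ℕ → ℝ) → ℝ}
    (hβ : ∀ k, Continuous (β k))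
    (hmono : ∀ h ∈ Set.pi Set.univ (fun _ : ℕ => Icc (0 : ℝ) γ), Monotone fun k => β k (revHist h k))
    (hBinf : ContinuousOn Binf (Set.pi Set.univ (fun _ : ℕ => Icc (0 : ℝ) γ)))
    (hlim : ∀ h ∈ Set.pi Set.univ (fun _ : ℕ => Icc (0 : ℝ) γ), Tendsto (fun k => β k (revHist h k)) atTop (𝓝 (Binf h)))
    {ε : ℝ} (hε : 0 < ε) :
    ∃ J : ℕ, ∀ j n : ℕ, J ≤ j → ∀ h : ℕ → ℝ, SeqBox γ h →
      |β (j + n) (revHist h (j + n)) - β j (revHist h j)| ≤ ε := by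
  obtain ⟨J, hJ⟩ := shift_eventually_small_of_monotone hβ hmono hBinf hlim hε
  exact ⟨J, fun j n hj h hh => hJ j n hj h (mem_closedBox_of_seqBox hh)⟩

end Summit.QuantumFields.BalabanUV.T4Continuum.Spine.NE4.KingCurrencyDini
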